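import Summits.AtomisticToContinuum.BoseEinsteinCondensation.Theorems.BECCutLineWeakDisorderGroundStateRigidityStubSectorExclusionAux
import Summits.AtomisticToContinuum.BoseEinsteinCondensation.Theorems.BECCutLineWeakDisorderGroundStateRigidityStubSectorExclusionAux2
import HarnessLib

/-!
# Crux `GroundStateRigidity` (stmt-AtomisticToContinuum-9072), line `Sketch` (skeleton v9):
# helpers for the registered stub `stub_sectorExclusion` (Stub C) — the energy floor on sectors

Supports (does not close) stmt-AtomisticToContinuum-9072; third auxiliary file of stub
`stub_sectorExclusion` of line Sketch (lead c5), namespace `GroundStateRigidity.SectorExclusion`.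
For a FINITE-ENERGY trial state `Φ` of `N + 1` hard-core bosons (`v = ⊤` on `[0, b]`) and a
sector `T` (a union of components of the free region), `T.indicator Φ.ψ` is an admissible `C¹`
Dirichlet function (`contDiff_sector_indicator`, by the clopen surgery lemma), whence:

* `floor_card`: `E₀(N+1, L) · ∫_T |Φ|² ≤ ∫_T e_Φ` for the `S_{N+1}`-invariant sectors
  `T = {#pm = m}` (variational principle `groundStateEnergy_mul_normSq_le`);
* `floor_member`: `(E₀(N, L) + c/b²) · ∫_T |Φ|² ≤ ∫_T e_Φ` for `T = {i ∈ pm, #pm = m}`: the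
  `N` particles `≠ i` are extracted fibrewise (`groundStateEnergy_mul_le_setLIntegral_group`
  with the group `i.succAbove`, symmetry under the permutations fixing `i`), and particle `i`'s
  kinetic energy pays `c/b²` per unit mass by the neighbour-Poincaré HYPOTHESIS (on `T`
  particle `i` always has a neighbour within `2b`);
* `floor_crowded`: summing over `i` counts each point of `{#pm = m}` exactly `m` times, and
  summing over `m ≥ 1` gives `(E₀(N, L) + c/b²) · ∫_{U'} |Φ|² ≤ ∫_{U'} e_Φ` on the crowded
  sector `U' = {#pm ≠ 0}`;
* `key`: with the gap `E₀(N+1) + g ≤ E₀(N) + c/b²` and `floor_card` on `{#pm = 0}`: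
  `E₀(N+1, L) + g · ∫_{U'} |Φ|² ≤ energy v Φ` for EVERY trial state `Φ`.

Here `e_Φ = |∇Φ|² + (∑ v)|Φ|²` is the energy density.
-/

noncomputable section

open MeasureTheory Filter Set Metric
open scoped ENNReal NNReal Topology

namespace Summit.AtomisticToContinuum.BoseEinsteinCondensation.Theorems.GroundStateRigidity

open Literature.MathematicalPhysics.QuantumManyBody.BoseGas

namespace SectorExclusion

variable {N : ℕ} {L b : ℝ} {v : ℝ → ℝ≥0∞}

/-! ### Sector states are admissible -/

/-- **Sector states.** For a finite-energy trial state `Φ` of a hard-core gas and any sector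
`T`, `T.indicator Φ.ψ` is `C¹` with `fderiv (T.indicator Φ.ψ) = T.indicator (fderiv Φ.ψ)`
(clopen surgery: `T` and the complementary sector are open, and `Φ.ψ`, `fderiv Φ.ψ` vanish off
the free region). [folklore] -/
theorem contDiff_sector_indicator (hb : 0 < b) (hcore : ∀ s : ℝ, s ∈ Set.Icc 0 b → v s = ⊤)
    (Φ : TrialState N L) (hE : energy v Φ < ⊤) (𝒜 : Set (Finset (Fin N))) :
    ContDiff ℝ 1 ((sector N L b 𝒜).indicator Φ.ψ) ∧
      ∀ X, fderiv ℝ ((sector N L b 𝒜).indicator Φ.ψ) X =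
        (sector N L b 𝒜).indicator (fderiv ℝ Φ.ψ) X :=
  contDiff_indicator Φ.contDiff (isOpen_sector 𝒜) (isOpen_sector 𝒜ᶜ) (disjoint_sector_compl 𝒜)
    (fun _ h1 h2 => psi_eq_zero_of_not_mem_free hb hcore Φ hE
      (not_mem_free_of_not_mem_sector h1 h2))
    (fun _ h1 h2 => fderiv_eq_zero_of_not_mem_free hb hcore Φ hE
      (not_mem_free_of_not_mem_sector h1 h2))

/-! ### The floor on symmetric sectors -/

/-- **Floor on an `S_N`-invariant sector**: `E₀(N, L) ∫_T |Φ|² ≤ ∫_T e_Φ` for `T = {#pm = m}`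
(the sector state is `C¹`, Dirichlet and Bose symmetric: variational principle).
[cite: LSSY2005, (2.3) and (2.52)–(2.53)] -/
theorem floor_card (hb : 0 < b) (hcore : ∀ s : ℝ, s ∈ Set.Icc 0 b → v s = ⊤)
    (Φ : TrialState N L) (hE : energy v Φ < ⊤) (m : ℕ) :
    groundStateEnergy v N L *
        ∫⁻ X, (sector N L b {s | s.card = m}).indicator (fun Y => (‖Φ.ψ Y‖₊ : ℝ≥0∞) ^ 2) X ≤
      ∫⁻ X, (sector N L b {s | s.card = m}).indicator
        (fun Y => kineticDensity Φ.ψ Y + interaction v Y * (‖Φ.ψ Y‖₊ : ℝ≥0∞) ^ 2) X := by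
  obtain ⟨hφ, hD⟩ := contDiff_sector_indicator hb hcore Φ hE {s | s.card = m}
  set T := sector N L b {s : Finset (Fin N) | s.card = m} with hT
  have h0 : ∀ Y, Y ∉ boxN N L → T.indicator Φ.ψ Y = 0 := fun Y hY =>
    indicator_of_notMem (fun h => hY h.1.1) _
  have hsymm : ∀ (σ : Equiv.Perm (Fin N)) (Y : Config N),
      T.indicator Φ.ψ (Y ∘ σ) = T.indicator Φ.ψ Y := fun σ Y =>
    indicator_comp_perm (fun X => comp_perm_mem_sector_card_iff X σ m) (Φ.symm σ) Y
  have key := groundStateEnergy_mul_normSq_le v hφ h0 hsymm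
  have e1 : ∫⁻ Y, (‖T.indicator Φ.ψ Y‖₊ : ℝ≥0∞) ^ 2 =
      ∫⁻ X, T.indicator (fun Y => (‖Φ.ψ Y‖₊ : ℝ≥0∞) ^ 2) X :=
    lintegral_congr fun X => normSq_indicator _ _ _
  have e2 : ∫⁻ Y, kineticDensity (T.indicator Φ.ψ) Y +
      interaction v Y * (‖T.indicator Φ.ψ Y‖₊ : ℝ≥0∞) ^ 2 =
      ∫⁻ X, T.indicator
        (fun Y => kineticDensity Φ.ψ Y + interaction v Y * (‖Φ.ψ Y‖₊ : ℝ≥0∞) ^ 2) X :=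
    lintegral_congr fun X => density_indicator v hD X
  rw [e1, e2] at key
  exact key

/-! ### The floor on the sectors with a fixed permanent member -/

/-- **Floor on `{i ∈ pm, #pm = m}`**: `(E₀(N, L) + c/b²) ∫_T |Φ|² ≤ ∫_T e_Φ`. The other `N`
particles (group `i.succAbove`; the sector state is symmetric under the permutations fixing
`i` and Dirichlet in each of them) contribute `≥ E₀(N, L) ∫_T |Φ|²` through their kinetic
energy and mutual interaction (`groundStateEnergy_mul_le_setLIntegral_group`); particle `i`'s
kinetic energy contributes `≥ (c/b²) ∫_T |Φ|²` by the neighbour-Poincaré hypothesis `hP`, as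
`T ⊆ {particle i has a neighbour within 2b}`; and `|∇Φ|² = |∇ᵢΦ|² + ∑_{j≠i} |∇ⱼΦ|²`,
`∑_{j<j', j,j'≠i} v ≤ ∑_{j<j'} v`. [cite: LSSY2005, (2.52)–(2.53)] -/
theorem floor_member (hb : 0 < b) (hv : Measurable v)
    (hcore : ∀ s : ℝ, s ∈ Set.Icc 0 b → v s = ⊤) {c : ℝ} {i : Fin (N + 1)}
    (hP : ∀ φ : Config (N + 1) → ℂ, ContDiff ℝ 1 φ →
        (∀ X : Config (N + 1), (∃ j j' : Fin (N + 1), j ≠ j' ∧ dist (X j) (X j') ≤ b) → φ X = 0) →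
        ENNReal.ofReal (c / b ^ 2) *
            ∫⁻ X, {Y : Config (N + 1) | ∃ j : Fin (N + 1), j ≠ i ∧ dist (Y i) (Y j) ≤ 2 * b}.indicator
              (fun Y => (‖φ Y‖₊ : ℝ≥0∞) ^ 2) X ≤
          ∫⁻ X, ∑ k : Fin 3,
            (‖fderiv ℝ φ X (Pi.single i (EuclideanSpace.single k (1 : ℝ)))‖₊ : ℝ≥0∞) ^ 2)
    (Φ : TrialState (N + 1) L) (hE : energy v Φ < ⊤) (m : ℕ) :
    (groundStateEnergy v N L + ENNReal.ofReal (c / b ^ 2)) *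
        ∫⁻ X, (sector (N + 1) L b {s | i ∈ s ∧ s.card = m}).indicator
          (fun Y => (‖Φ.ψ Y‖₊ : ℝ≥0∞) ^ 2) X ≤
      ∫⁻ X, (sector (N + 1) L b {s | i ∈ s ∧ s.card = m}).indicator
        (fun Y => kineticDensity Φ.ψ Y + interaction v Y * (‖Φ.ψ Y‖₊ : ℝ≥0∞) ^ 2) X := by
  obtain ⟨hφ, hD⟩ := contDiff_sector_indicator hb hcore Φ hE {s | i ∈ s ∧ s.card = m}
  set T := sector (N + 1) L b {s : Finset (Fin (N + 1)) | i ∈ s ∧ s.card = m} with hT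
  -- (1) particle `i`: the neighbour-Poincaré hypothesis
  have hK : ∀ X : Config (N + 1), (∃ j j' : Fin (N + 1), j ≠ j' ∧ dist (X j) (X j') ≤ b) →
      T.indicator Φ.ψ X = 0 := by
    rintro X ⟨j, j', hjj', hd⟩
    exact indicator_of_notMem (fun hX => (not_lt.2 hd) (hX.1.2 j j' hjj')) _
  have hP1 := hP (T.indicator Φ.ψ) hφ hK
  have hA : ∀ X, {Y : Config (N + 1) | ∃ j : Fin (N + 1), j ≠ i ∧ dist (Y i) (Y j) ≤ 2 * b}.indicator
      (fun Y => (‖T.indicator Φ.ψ Y‖₊ : ℝ≥0∞) ^ 2) X = (‖T.indicator Φ.ψ X‖₊ : ℝ≥0∞) ^ 2 := by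
    intro X
    refine Set.indicator_apply_eq_self.2 fun hXA => ?_
    have hXT : X ∉ T := fun hXT => hXA (mem_nbr_of_mem_pm hXT.1 hXT.2.1)
    simp [indicator_of_notMem hXT]
  have h1 : ENNReal.ofReal (c / b ^ 2) * ∫⁻ X, T.indicator (fun Y => (‖Φ.ψ Y‖₊ : ℝ≥0∞) ^ 2) X ≤
      ∫⁻ X, T.indicator (kineticOn (fun _ : Fin 1 => i) Φ.ψ) X := by
    have e1 : ∫⁻ X, {Y : Config (N + 1) | ∃ j : Fin (N + 1), j ≠ i ∧ dist (Y i) (Y j) ≤ 2 * b}.indicator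
        (fun Y => (‖T.indicator Φ.ψ Y‖₊ : ℝ≥0∞) ^ 2) X =
        ∫⁻ X, T.indicator (fun Y => (‖Φ.ψ Y‖₊ : ℝ≥0∞) ^ 2) X :=
      lintegral_congr fun X => by rw [hA X, normSq_indicator]
    have e2 : ∫⁻ X, ∑ k : Fin 3, (‖fderiv ℝ (T.indicator Φ.ψ) X
        (Pi.single i (EuclideanSpace.single k (1 : ℝ)))‖₊ : ℝ≥0∞) ^ 2 =
        ∫⁻ X, T.indicator (kineticOn (fun _ : Fin 1 => i) Φ.ψ) X :=
      lintegral_congr fun X => by rw [← kineticOn_one, kineticOn_indicator _ hD]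
    rw [e1, e2] at hP1
    exact hP1
  -- (2) the other particles: Dirichlet group extraction
  have hsymm : ∀ (τ : Equiv.Perm (Fin N)) (X : Config (N + 1)),
      T.indicator Φ.ψ (X ∘ (τ.extendDomain (Equiv.ofInjective (Fin.succAboveEmb i)
        (Fin.succAboveEmb i).injective))) = T.indicator Φ.ψ X := by
    intro τ X
    have hfix : (τ.extendDomain (Equiv.ofInjective (Fin.succAboveEmb i)
        (Fin.succAboveEmb i).injective)) i = i := by
      refine Equiv.Perm.extendDomain_apply_not_subtype _ _ ?_
      rintro ⟨l, hl⟩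
      exact Fin.succAbove_ne i l hl
    exact indicator_comp_perm (fun Y => comp_perm_mem_sector_member_iff Y hfix m) (Φ.symm _) X
  have hsupp : ∀ X : Config (N + 1), (∃ l, X (Fin.succAboveEmb i l) - 0 ∉ box L) →
      T.indicator Φ.ψ X = 0 := by
    rintro X ⟨l, hl⟩
    rw [sub_zero] at hl
    exact indicator_of_notMem (fun hX => hl (hX.1.1 _)) _
  have h2 := groundStateEnergy_mul_le_setLIntegral_group (Fin.succAboveEmb i) 0 L hv hφ hsymm
    hsupp Set.univ
  simp only [Set.mem_univ, Set.setOf_true, Measure.restrict_univ] at h2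
  have e3 : ∫⁻ X, (‖T.indicator Φ.ψ X‖₊ : ℝ≥0∞) ^ 2 =
      ∫⁻ X, T.indicator (fun Y => (‖Φ.ψ Y‖₊ : ℝ≥0∞) ^ 2) X :=
    lintegral_congr fun X => normSq_indicator _ _ _
  rw [e3] at h2
  -- (3) adding up
  calc (groundStateEnergy v N L + ENNReal.ofReal (c / b ^ 2)) *
        ∫⁻ X, T.indicator (fun Y => (‖Φ.ψ Y‖₊ : ℝ≥0∞) ^ 2) X
      = groundStateEnergy v N L * (∫⁻ X, T.indicator (fun Y => (‖Φ.ψ Y‖₊ : ℝ≥0∞) ^ 2) X) +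
          ENNReal.ofReal (c / b ^ 2) * ∫⁻ X, T.indicator (fun Y => (‖Φ.ψ Y‖₊ : ℝ≥0∞) ^ 2) X :=
        add_mul _ _ _
    _ ≤ (∫⁻ X, kineticOn (Fin.succAboveEmb i) (T.indicator Φ.ψ) X +
          interactionOn (Fin.succAboveEmb i) v X * (‖T.indicator Φ.ψ X‖₊ : ℝ≥0∞) ^ 2) +
          ∫⁻ X, T.indicator (kineticOn (fun _ : Fin 1 => i) Φ.ψ) X := add_le_add h2 h1
    _ ≤ ∫⁻ X, kineticOn (Fin.succAboveEmb i) (T.indicator Φ.ψ) X +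
          interactionOn (Fin.succAboveEmb i) v X * (‖T.indicator Φ.ψ X‖₊ : ℝ≥0∞) ^ 2 +
          T.indicator (kineticOn (fun _ : Fin 1 => i) Φ.ψ) X := le_lintegral_add _ _
    _ ≤ _ := lintegral_mono fun X => ?_
  rw [← density_indicator v hD X, ← kineticOn_indicator _ hD X,
    kineticDensity_eq_kineticOn_one_add i]
  calc kineticOn (Fin.succAboveEmb i) (T.indicator Φ.ψ) X +
        interactionOn (Fin.succAboveEmb i) v X * (‖T.indicator Φ.ψ X‖₊ : ℝ≥0∞) ^ 2 +
        kineticOn (fun _ : Fin 1 => i) (T.indicator Φ.ψ) X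
      ≤ kineticOn i.succAbove (T.indicator Φ.ψ) X +
        interaction v X * (‖T.indicator Φ.ψ X‖₊ : ℝ≥0∞) ^ 2 +
        kineticOn (fun _ : Fin 1 => i) (T.indicator Φ.ψ) X := by
        gcongr
        · exact le_rfl
        · exact interactionOn_succAbove_le i v X
    _ = _ := by ring

/-! ### Counting: the floor on the crowded sector -/

/-- **Floor on `{#pm = m}`, `m ≥ 1`**: summing `floor_member` over `i` counts each point of
`{#pm = m}` exactly `m` times on both sides; divide by `m`. [folklore] -/
theorem floor_crowded_card (hb : 0 < b) (hv : Measurable v)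
    (hcore : ∀ s : ℝ, s ∈ Set.Icc 0 b → v s = ⊤) {c : ℝ}
    (hP : ∀ (i : Fin (N + 1)) (φ : Config (N + 1) → ℂ), ContDiff ℝ 1 φ →
        (∀ X : Config (N + 1), (∃ j j' : Fin (N + 1), j ≠ j' ∧ dist (X j) (X j') ≤ b) → φ X = 0) →
        ENNReal.ofReal (c / b ^ 2) *
            ∫⁻ X, {Y : Config (N + 1) | ∃ j : Fin (N + 1), j ≠ i ∧ dist (Y i) (Y j) ≤ 2 * b}.indicator
              (fun Y => (‖φ Y‖₊ : ℝ≥0∞) ^ 2) X ≤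
          ∫⁻ X, ∑ k : Fin 3,
            (‖fderiv ℝ φ X (Pi.single i (EuclideanSpace.single k (1 : ℝ)))‖₊ : ℝ≥0∞) ^ 2)
    (Φ : TrialState (N + 1) L) (hE : energy v Φ < ⊤) {m : ℕ} (hm : m ≠ 0) :
    (groundStateEnergy v N L + ENNReal.ofReal (c / b ^ 2)) *
        ∫⁻ X, (sector (N + 1) L b {s | s.card = m}).indicator
          (fun Y => (‖Φ.ψ Y‖₊ : ℝ≥0∞) ^ 2) X ≤
      ∫⁻ X, (sector (N + 1) L b {s | s.card = m}).indicator
        (fun Y => kineticDensity Φ.ψ Y + interaction v Y * (‖Φ.ψ Y‖₊ : ℝ≥0∞) ^ 2) X := by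
  have hmn : Measurable fun Y => (‖Φ.ψ Y‖₊ : ℝ≥0∞) ^ 2 := measurable_normSq Φ.contDiff.continuous
  have hme : Measurable fun Y => kineticDensity Φ.ψ Y + interaction v Y * (‖Φ.ψ Y‖₊ : ℝ≥0∞) ^ 2 :=
    (measurable_kineticDensity Φ.contDiff).add ((measurable_interaction hv).mul hmn)
  have hsum := Finset.sum_le_sum fun i (_ : i ∈ Finset.univ) =>
    floor_member hb hv hcore (hP i) Φ hE m
  rw [← Finset.mul_sum,
    ← lintegral_finsetSum _ (fun i _ => hmn.indicator (measurableSet_sector _)),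
    ← lintegral_finsetSum _ (fun i _ => hme.indicator (measurableSet_sector _))] at hsum
  simp only [sum_indicator_member] at hsum
  rw [lintegral_const_mul _ (hmn.indicator (measurableSet_sector _)),
    lintegral_const_mul _ (hme.indicator (measurableSet_sector _)), mul_left_comm] at hsum
  exact (ENNReal.mul_le_mul_iff_right (by exact_mod_cast hm) (ENNReal.natCast_ne_top m)).1 hsum

/-- **Floor on the crowded sector** `U' = {#pm ≠ 0}`:
`(E₀(N, L) + c/b²) ∫_{U'} |Φ|² ≤ ∫_{U'} e_Φ` (sum of `floor_crowded_card` over `m = 1, …, N+1`).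
[folklore] -/
theorem floor_crowded (hb : 0 < b) (hv : Measurable v)
    (hcore : ∀ s : ℝ, s ∈ Set.Icc 0 b → v s = ⊤) {c : ℝ}
    (hP : ∀ (i : Fin (N + 1)) (φ : Config (N + 1) → ℂ), ContDiff ℝ 1 φ →
        (∀ X : Config (N + 1), (∃ j j' : Fin (N + 1), j ≠ j' ∧ dist (X j) (X j') ≤ b) → φ X = 0) →
        ENNReal.ofReal (c / b ^ 2) *
            ∫⁻ X, {Y : Config (N + 1) | ∃ j : Fin (N + 1), j ≠ i ∧ dist (Y i) (Y j) ≤ 2 * b}.indicator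
              (fun Y => (‖φ Y‖₊ : ℝ≥0∞) ^ 2) X ≤
          ∫⁻ X, ∑ k : Fin 3,
            (‖fderiv ℝ φ X (Pi.single i (EuclideanSpace.single k (1 : ℝ)))‖₊ : ℝ≥0∞) ^ 2)
    (Φ : TrialState (N + 1) L) (hE : energy v Φ < ⊤) :
    (groundStateEnergy v N L + ENNReal.ofReal (c / b ^ 2)) *
        ∫⁻ X, (sector (N + 1) L b {s | s.card = 0}ᶜ).indicator
          (fun Y => (‖Φ.ψ Y‖₊ : ℝ≥0∞) ^ 2) X ≤
      ∫⁻ X, (sector (N + 1) L b {s | s.card = 0}ᶜ).indicator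
        (fun Y => kineticDensity Φ.ψ Y + interaction v Y * (‖Φ.ψ Y‖₊ : ℝ≥0∞) ^ 2) X := by
  have hmn : Measurable fun Y => (‖Φ.ψ Y‖₊ : ℝ≥0∞) ^ 2 := measurable_normSq Φ.contDiff.continuous
  have hme : Measurable fun Y => kineticDensity Φ.ψ Y + interaction v Y * (‖Φ.ψ Y‖₊ : ℝ≥0∞) ^ 2 :=
    (measurable_kineticDensity Φ.contDiff).add ((measurable_interaction hv).mul hmn)
  simp only [indicator_crowded_eq_sum]
  rw [lintegral_finsetSum _ (fun m _ => hmn.indicator (measurableSet_sector _)),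
    lintegral_finsetSum _ (fun m _ => hme.indicator (measurableSet_sector _)), Finset.mul_sum]
  refine Finset.sum_le_sum fun m hm => floor_crowded_card hb hv hcore hP Φ hE ?_
  exact Nat.pos_iff_ne_zero.1 (Finset.mem_Icc.1 hm).1

/-! ### The key inequality -/

/-- **Key inequality.** Under the gap `E₀(N+1, L) + g ≤ E₀(N, L) + c/b²`, every trial state
`Φ` of `N + 1` hard-core bosons pays `g` per unit of mass on the crowded sector:
`E₀(N+1, L) + g ∫_{U'} |Φ|² ≤ ⟨Φ, H Φ⟩` (trivial at infinite energy; otherwise `floor_card` on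
`{#pm = 0}`, `floor_crowded` on `U'`, `∫_{#pm = 0} |Φ|² + ∫_{U'} |Φ|² = 1` as `Φ` vanishes off
the free region, and `∫_{#pm=0} e_Φ + ∫_{U'} e_Φ ≤ energy`). [cite: LSSY2005, (2.52)–(2.53)] -/
theorem key (hb : 0 < b) (hv : Measurable v)
    (hcore : ∀ s : ℝ, s ∈ Set.Icc 0 b → v s = ⊤) {c : ℝ} {g : ℝ≥0∞}
    (hP : ∀ (i : Fin (N + 1)) (φ : Config (N + 1) → ℂ), ContDiff ℝ 1 φ →
        (∀ X : Config (N + 1), (∃ j j' : Fin (N + 1), j ≠ j' ∧ dist (X j) (X j') ≤ b) → φ X = 0) →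
        ENNReal.ofReal (c / b ^ 2) *
            ∫⁻ X, {Y : Config (N + 1) | ∃ j : Fin (N + 1), j ≠ i ∧ dist (Y i) (Y j) ≤ 2 * b}.indicator
              (fun Y => (‖φ Y‖₊ : ℝ≥0∞) ^ 2) X ≤
          ∫⁻ X, ∑ k : Fin 3,
            (‖fderiv ℝ φ X (Pi.single i (EuclideanSpace.single k (1 : ℝ)))‖₊ : ℝ≥0∞) ^ 2)
    (hgap : groundStateEnergy v (N + 1) L + g ≤ groundStateEnergy v N L + ENNReal.ofReal (c / b ^ 2))
    (Φ : TrialState (N + 1) L) :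
    groundStateEnergy v (N + 1) L +
        g * ∫⁻ X, (sector (N + 1) L b {s | s.card = 0}ᶜ).indicator
          (fun Y => (‖Φ.ψ Y‖₊ : ℝ≥0∞) ^ 2) X ≤ energy v Φ := by
  by_cases hE : energy v Φ < ⊤
  swap
  · rw [not_lt, top_le_iff] at hE
    rw [hE]
    exact le_top
  have hmn : Measurable fun Y => (‖Φ.ψ Y‖₊ : ℝ≥0∞) ^ 2 := measurable_normSq Φ.contDiff.continuous
  have hme : Measurable fun Y => kineticDensity Φ.ψ Y + interaction v Y * (‖Φ.ψ Y‖₊ : ℝ≥0∞) ^ 2 :=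
    (measurable_kineticDensity Φ.contDiff).add ((measurable_interaction hv).mul hmn)
  set S := sector (N + 1) L b {s : Finset (Fin (N + 1)) | s.card = 0} with hS
  set U := sector (N + 1) L b {s : Finset (Fin (N + 1)) | s.card = 0}ᶜ with hU
  have hfS := floor_card hb hcore Φ hE 0
  have hfU := (mul_le_mul_left hgap _).trans (floor_crowded hb hv hcore hP Φ hE)
  rw [← hS] at hfS
  rw [← hU] at hfU
  -- masses add up to one, energies to at most the energy
  have hn0 : ∀ X, X ∉ free (N + 1) L b → (fun Y => (‖Φ.ψ Y‖₊ : ℝ≥0∞) ^ 2) X = 0 := fun X hX => by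
    simp [psi_eq_zero_of_not_mem_free hb hcore Φ hE hX]
  have hmass : (∫⁻ X, S.indicator (fun Y => (‖Φ.ψ Y‖₊ : ℝ≥0∞) ^ 2) X) +
      ∫⁻ X, U.indicator (fun Y => (‖Φ.ψ Y‖₊ : ℝ≥0∞) ^ 2) X = 1 := by
    rw [← lintegral_add_left (hmn.indicator (measurableSet_sector _)), ← Φ.norm_eq]
    exact lintegral_congr fun X => indicator_sector_add_compl _ hn0 X
  have henergy : (∫⁻ X, S.indicator
        (fun Y => kineticDensity Φ.ψ Y + interaction v Y * (‖Φ.ψ Y‖₊ : ℝ≥0∞) ^ 2) X) +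
      ∫⁻ X, U.indicator
        (fun Y => kineticDensity Φ.ψ Y + interaction v Y * (‖Φ.ψ Y‖₊ : ℝ≥0∞) ^ 2) X ≤
      energy v Φ := by
    rw [← lintegral_add_left (hme.indicator (measurableSet_sector _))]
    refine lintegral_mono fun X => ?_
    have hsplit := congrFun (indicator_union_of_disjoint
      (disjoint_sector_compl (N := N + 1) (L := L) (b := b) {s | s.card = 0})
      (fun Y => kineticDensity Φ.ψ Y + interaction v Y * (‖Φ.ψ Y‖₊ : ℝ≥0∞) ^ 2)) X
    exact (le_of_eq hsplit.symm).trans (indicator_le_self _ _ X)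
  calc groundStateEnergy v (N + 1) L +
        g * ∫⁻ X, U.indicator (fun Y => (‖Φ.ψ Y‖₊ : ℝ≥0∞) ^ 2) X
      = groundStateEnergy v (N + 1) L * ((∫⁻ X, S.indicator (fun Y => (‖Φ.ψ Y‖₊ : ℝ≥0∞) ^ 2) X) +
          ∫⁻ X, U.indicator (fun Y => (‖Φ.ψ Y‖₊ : ℝ≥0∞) ^ 2) X) +
          g * ∫⁻ X, U.indicator (fun Y => (‖Φ.ψ Y‖₊ : ℝ≥0∞) ^ 2) X := by rw [hmass, mul_one]
    _ = groundStateEnergy v (N + 1) L * (∫⁻ X, S.indicator (fun Y => (‖Φ.ψ Y‖₊ : ℝ≥0∞) ^ 2) X) +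
          (groundStateEnergy v (N + 1) L + g) *
            ∫⁻ X, U.indicator (fun Y => (‖Φ.ψ Y‖₊ : ℝ≥0∞) ^ 2) X := by ring
    _ ≤ _ := add_le_add hfS hfU
    _ ≤ energy v Φ := henergy

end SectorExclusion

end Summit.AtomisticToContinuum.BoseEinsteinCondensation.Theorems.GroundStateRigidity

end
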